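import Summits.Ventures.PackingBounds.Configurations.LeechCard4600

/-!
# Laminated sections of the Leech kissing configuration, I: the section conditions shape by shape

Framing: lottery ticket; floor = certified bounds/negative ranges. Venture `PackingBounds` (cell
`pub-packcert`, seat `pub-packcert-energy`).

The minimal vectors of the Leech lattice orthogonal to the minimal vector `x₀ = (4,4,0²²)`, to the `A₂`-pair
`x₀, x₁ = (4,0,4,0²¹)`, and to the `A₃`-triple `x₀, z₁ = (-4,0,4,0²¹), z₂ = (0,-4,0,4,0²⁰)` are the kissing
configurations of the laminated lattices `Λ₂₃, Λ₂₂, Λ₂₁` [Conway–Sloane, Ch. 6]; in coordinates the three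
conditions read `y₁ = -y₀`; `y₁ = y₂ = -y₀`; `y₁ = -y₀, y₂ = y₀, y₃ = -y₀`. This file characterises
the three conditions on the shape-`C` and shape-`B` vectors in terms of their indices (message bits; octad
through / avoiding the first coordinates and sign bits — the coordinates `0, …, c` of an octad containing them are
its first `c + 1` positions, `opos_symm_val_of_prefix`). `LeechSectionCount.lean` does the counting and
`LeechSections.lean` the transfer to `ℝ²³, ℝ²², ℝ²¹` (`κ(23) ≥ 93150`, `κ(22) ≥ 49896`, `κ(21) ≥ 27720`).

## References
* J. H. Conway, N. J. A. Sloane, *Sphere Packings, Lattices and Groups*, Ch. 6 (laminated lattices,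
  Table 6.1) and Ch. 1 Table 1.2. [`ConwaySloane1999`]
-/

namespace Summit.Ventures.PackingBounds.Config.Leech

open Finset Golay

/-! ### The three section conditions

* `Λ₂₃`: orthogonal to `x₀ = (4,4,0,…)`: `y 0 + y 1 = 0`;
* `Λ₂₂`: orthogonal to `x₀` and `x₁ = (4,0,4,0,…)`: `y 0 + y 1 = 0 ∧ y 0 + y 2 = 0`;
* `Λ₂₁`: orthogonal to `x₀`, `z₁ = (-4,0,4,0,…)`, `z₂ = (0,-4,0,4,0,…)`: `y 0 + y 1 = 0 ∧ y 2 - y 0 = 0 ∧ y 3 - y 1 = 0`.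
-/

/-! ### Octad positions of a prefix of coordinates -/

/-- Values of the octad enumeration compared through `Fin 24`. -/
theorem opos_val_lt_of_lt (o : Fin 759) {r r' : Fin 8} (h : r < r') :
    ((opos o r : osupp o) : Fin 24).val < ((opos o r' : osupp o) : Fin 24).val :=
  Fin.lt_def.mp (Subtype.coe_lt_coe.mpr ((opos o).strictMono h))

/-- If the coordinates `0, …, c` all lie in the octad `o`, they are its first `c + 1` positions. -/
theorem opos_val_eq_of_prefix (o : Fin 759) {c : ℕ} (h : ∀ j : Fin 24, j.val ≤ c → j ∈ osupp o) :
    ∀ (m : ℕ) (r : Fin 8), r.val = m → m ≤ c → ((opos o r : osupp o) : Fin 24).val = m := by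
  intro m
  induction m using Nat.strong_induction_on with
  | _ m ih =>
    intro r hrm hm
    have h24 := ((opos o r : osupp o) : Fin 24).isLt
    apply le_antisymm
    · by_contra hgt
      rw [not_le] at hgt
      obtain ⟨r'', hr''⟩ := (opos o).surjective ⟨⟨m, by omega⟩, h ⟨m, by omega⟩ hm⟩
      have hv'' : ((opos o r'' : osupp o) : Fin 24).val = m := by rw [hr'']
      have hlt : r'' < r := by
        by_contra hge
        rw [not_lt] at hge
        rcases hge.lt_or_eq with hlt' | heq
        · have := opos_val_lt_of_lt o hlt'; omega
        · rw [← heq] at hv''; omega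
      have hih := ih r''.val (by rw [← hrm]; exact hlt) r'' rfl (by have := Fin.lt_def.mp hlt; omega)
      have := Fin.lt_def.mp hlt
      omega
    · rcases Nat.eq_zero_or_pos m with h0 | hpos
      · omega
      · have hr1 : (⟨m - 1, by omega⟩ : Fin 8) < r := by rw [Fin.lt_def]; simp only; omega
        have hprev := ih (m - 1) (by omega) ⟨m - 1, by omega⟩ rfl (by omega)
        have hsm := opos_val_lt_of_lt o hr1
        omega

/-- A prefix `{0, …, c}` of coordinates inside an octad has `c < 8`. -/
theorem prefix_lt_eight (o : Fin 759) {c : ℕ} (h : ∀ j : Fin 24, j.val ≤ c → j ∈ osupp o) : c < 8 := by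
  by_contra hc8
  have hsub : (Finset.univ.filter fun j : Fin 24 => j.val ≤ 8) ⊆ osupp o := fun j hj =>
    h j (by have := (Finset.mem_filter.mp hj).2; omega)
  have := Finset.card_le_card hsub
  rw [card_osupp] at this
  have h9 : (Finset.univ.filter fun j : Fin 24 => j.val ≤ 8).card = 9 := by decide
  omega

/-- Rank of a prefix coordinate: if `0, …, c ∈ o` then coordinate `j ≤ c` is the `j`-th octad position. -/
theorem opos_symm_val_of_prefix (o : Fin 759) {c : ℕ} (h : ∀ j : Fin 24, j.val ≤ c → j ∈ osupp o)
    (j : Fin 24) (hj : j.val ≤ c) : ((opos o).symm ⟨j, h j hj⟩).val = j.val := by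
  have hc := prefix_lt_eight o h
  set r := (opos o).symm ⟨j, h j hj⟩ with hr
  have hv : ((opos o r : osupp o) : Fin 24).val = j.val := by
    have := OrderIso.apply_symm_apply (opos o) ⟨j, h j hj⟩
    rw [← hr] at this
    exact congrArg (fun z : osupp o => (z : Fin 24).val) this
  have h2 := opos_val_eq_of_prefix o h j.val ⟨j.val, by omega⟩ rfl hj
  by_contra hne
  rcases lt_or_gt_of_ne (show r ≠ ⟨j.val, by omega⟩ from fun e => hne (by rw [e])) with hlt | hgt
  · have := opos_val_lt_of_lt o hlt; omega
  · have := opos_val_lt_of_lt o hgt; omega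

/-- Shape-`B` values on a prefix of coordinates contained in the octad (`c < 7`): the sign bits are the bits of `v`. -/
theorem bvec_apply_prefix (o : Fin 759) (v : ℕ) {c : ℕ} (hc : c < 7) (h : ∀ j : Fin 24, j.val ≤ c → j ∈ osupp o)
    (j : Fin 24) (hj : j.val ≤ c) : bvec o v j = 2 * sgn (v.testBit j.val) := by
  have hr := opos_symm_val_of_prefix o h j hj
  simp only [bvec, dif_pos (h j hj), bbit, hr, show j.val < 7 by omega, if_true]

/-! ### Shape `C` -/

/-- Coordinates `j ≠ i`, `j < 12`, of a shape-`C` vector are the signs of the message bits. -/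
theorem cvec_apply_ne {i j : Fin 24} (hji : j ≠ i) (hj : j.val < 12) {u : ℕ} (hu : u < 4096) :
    cvec i u j = sgn (u.testBit j.val) := by
  simp only [cvec, if_neg hji, mul_one, testBit_cw_low hu hj]

/-- The coordinate `i < 12` of a shape-`C` vector. -/
theorem cvec_apply_self {i : Fin 24} (hi : i.val < 12) {u : ℕ} (hu : u < 4096) :
    cvec i u i = -3 * sgn (u.testBit i.val) := by
  simp [cvec, testBit_cw_low hu hi]; ring

/-- `Λ₂₃`-condition on shape `C`. -/
theorem P23_cvec_iff (i : Fin 24) {u : ℕ} (hu : u < 4096) :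
    (cvec i u) 0 + (cvec i u) 1 = 0 ↔ (i ≠ 0 ∧ i ≠ 1) ∧ u.testBit 1 = !u.testBit 0 := by
  by_cases h0 : i = 0
  · subst h0
    rw [cvec_apply_self (by decide) hu, cvec_apply_ne (by decide) (by decide) hu]
    rcases sgn_cases (u.testBit (0 : Fin 24).val) with ha | ha <;>
      rcases sgn_cases (u.testBit (1 : Fin 24).val) with hb | hb <;> rw [ha, hb] <;> simp
  by_cases h1 : i = 1
  · subst h1
    rw [cvec_apply_self (by decide) hu, cvec_apply_ne (by decide) (by decide) hu]
    rcases sgn_cases (u.testBit (0 : Fin 24).val) with ha | ha <;>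
      rcases sgn_cases (u.testBit (1 : Fin 24).val) with hb | hb <;> rw [ha, hb] <;> simp
  rw [cvec_apply_ne (Ne.symm h0) (by decide) hu, cvec_apply_ne (Ne.symm h1) (by decide) hu]
  simp only [Fin.val_zero, Fin.val_one, ne_eq, h0, h1, not_false_eq_true, and_self, true_and]
  cases u.testBit 0 <;> cases u.testBit 1 <;> simp

/-- `Λ₂₂`-condition on shape `C`. -/
theorem P22_cvec_iff (i : Fin 24) {u : ℕ} (hu : u < 4096) :
    ((cvec i u) 0 + (cvec i u) 1 = 0 ∧ (cvec i u) 0 + (cvec i u) 2 = 0) ↔ (i ≠ 0 ∧ i ≠ 1 ∧ i ≠ 2) ∧ (u.testBit 1 = !u.testBit 0 ∧ u.testBit 2 = !u.testBit 0) := by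
  by_cases h0 : i = 0
  · subst h0
    rw [cvec_apply_self (by decide) hu, cvec_apply_ne (by decide) (by decide) hu]
    rcases sgn_cases (u.testBit (0 : Fin 24).val) with ha | ha <;>
      rcases sgn_cases (u.testBit (1 : Fin 24).val) with hb | hb <;> rw [ha, hb] <;> simp
  by_cases h1 : i = 1
  · subst h1
    rw [cvec_apply_self (by decide) hu, cvec_apply_ne (by decide) (by decide) hu]
    rcases sgn_cases (u.testBit (0 : Fin 24).val) with ha | ha <;>
      rcases sgn_cases (u.testBit (1 : Fin 24).val) with hb | hb <;> rw [ha, hb] <;> simp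
  by_cases h2 : i = 2
  · subst h2
    rw [cvec_apply_self (by decide) hu, cvec_apply_ne (by decide) (by decide) hu]
    rcases sgn_cases (u.testBit (0 : Fin 24).val) with ha | ha <;>
      rcases sgn_cases (u.testBit (2 : Fin 24).val) with hb | hb <;> rw [ha, hb] <;> simp
  rw [cvec_apply_ne (Ne.symm h0) (by decide) hu, cvec_apply_ne (Ne.symm h1) (by decide) hu,
    cvec_apply_ne (Ne.symm h2) (by decide) hu]
  simp only [Fin.val_zero, Fin.val_one, Fin.val_two, ne_eq, h0, h1, h2, not_false_eq_true, and_self, true_and]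
  cases u.testBit 0 <;> cases u.testBit 1 <;> cases u.testBit 2 <;> simp

/-- `Λ₂₁`-condition on shape `C`. -/
theorem P21_cvec_iff (i : Fin 24) {u : ℕ} (hu : u < 4096) :
    ((cvec i u) 0 + (cvec i u) 1 = 0 ∧ (cvec i u) 2 - (cvec i u) 0 = 0 ∧ (cvec i u) 3 - (cvec i u) 1 = 0) ↔ (i ≠ 0 ∧ i ≠ 1 ∧ i ≠ 2 ∧ i ≠ 3) ∧
      (u.testBit 1 = !u.testBit 0 ∧ u.testBit 2 = u.testBit 0 ∧ u.testBit 3 = !u.testBit 0) := by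
  have h3v : (3 : Fin 24).val = 3 := rfl
  by_cases h0 : i = 0
  · subst h0
    rw [cvec_apply_self (by decide) hu, cvec_apply_ne (by decide) (by decide) hu]
    rcases sgn_cases (u.testBit (0 : Fin 24).val) with ha | ha <;>
      rcases sgn_cases (u.testBit (1 : Fin 24).val) with hb | hb <;> rw [ha, hb] <;> simp
  by_cases h1 : i = 1
  · subst h1
    rw [cvec_apply_self (by decide) hu, cvec_apply_ne (by decide) (by decide) hu]
    rcases sgn_cases (u.testBit (0 : Fin 24).val) with ha | ha <;>
      rcases sgn_cases (u.testBit (1 : Fin 24).val) with hb | hb <;> rw [ha, hb] <;> simp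
  by_cases h2 : i = 2
  · subst h2
    rw [cvec_apply_self (by decide) hu, cvec_apply_ne (by decide) (by decide) hu]
    rcases sgn_cases (u.testBit (0 : Fin 24).val) with ha | ha <;>
      rcases sgn_cases (u.testBit (2 : Fin 24).val) with hb | hb <;> rw [ha, hb] <;> simp
  by_cases h3 : i = 3
  · subst h3
    rw [cvec_apply_self (by decide) hu, cvec_apply_ne (by decide) (by decide) hu,
      cvec_apply_ne (by decide) (by decide) hu]
    rcases sgn_cases (u.testBit (0 : Fin 24).val) with ha | ha <;>
      rcases sgn_cases (u.testBit (1 : Fin 24).val) with hb | hb <;>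
      rcases sgn_cases (u.testBit (3 : Fin 24).val) with hc | hc <;> rw [ha, hb, hc] <;> simp
  rw [cvec_apply_ne (Ne.symm h0) (by decide) hu, cvec_apply_ne (Ne.symm h1) (by decide) hu,
    cvec_apply_ne (Ne.symm h2) (by decide) hu, cvec_apply_ne (Ne.symm h3) (by decide) hu]
  simp only [Fin.val_zero, Fin.val_one, Fin.val_two, h3v, ne_eq, h0, h1, h2, h3, not_false_eq_true, and_self,
    true_and]
  cases u.testBit 0 <;> cases u.testBit 1 <;> cases u.testBit 2 <;> cases u.testBit 3 <;> simp

/-! ### Shape `B` -/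

/-- A shape-`B` coordinate vanishes exactly off the octad. -/
theorem bvec_eq_zero_iff (o : Fin 759) (v : ℕ) (j : Fin 24) : bvec o v j = 0 ↔ j ∉ osupp o := by
  have := bvec_ne_zero_iff o v j
  tauto

/-- Two signs with `2 sgn b + 2 sgn b' = 0`. -/
theorem sgn_add_sgn_eq_zero_iff (b b' : Bool) : 2 * sgn b + 2 * sgn b' = 0 ↔ b' = !b := by
  cases b <;> cases b' <;> simp

/-- Two signs with `2 sgn b' - 2 sgn b = 0`. -/
theorem sgn_sub_sgn_eq_zero_iff (b b' : Bool) : 2 * sgn b' - 2 * sgn b = 0 ↔ b' = b := by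
  cases b <;> cases b' <;> simp

/-- `Λ₂₃`-condition on shape `B`. -/
theorem P23_bvec_iff (o : Fin 759) (v : ℕ) :
    (bvec o v) 0 + (bvec o v) 1 = 0 ↔ ((0 : Fin 24) ∉ osupp o ∧ (1 : Fin 24) ∉ osupp o) ∨
      (((0 : Fin 24) ∈ osupp o ∧ (1 : Fin 24) ∈ osupp o) ∧ v.testBit 1 = !v.testBit 0) := by
  by_cases h0 : (0 : Fin 24) ∈ osupp o
  · by_cases h1 : (1 : Fin 24) ∈ osupp o
    · have hp : ∀ j : Fin 24, j.val ≤ 1 → j ∈ osupp o := by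
        intro j hj
        rcases Nat.le_one_iff_eq_zero_or_eq_one.mp hj with h | h
        · rw [show j = 0 from Fin.ext h]; exact h0
        · rw [show j = 1 from Fin.ext h]; exact h1
      rw [bvec_apply_prefix o v (by norm_num) hp 0 (by decide), bvec_apply_prefix o v (by norm_num) hp 1 (by decide)]
      simp [h0, h1, sgn_add_sgn_eq_zero_iff]
    · rw [(bvec_eq_zero_iff o v 1).mpr h1, add_zero]
      simp [h0, h1, bvec_eq_zero_iff]
  · rw [(bvec_eq_zero_iff o v 0).mpr h0, zero_add]
    simp [h0, bvec_eq_zero_iff]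

/-- `Λ₂₂`-condition on shape `B`. -/
theorem P22_bvec_iff (o : Fin 759) (v : ℕ) :
    ((bvec o v) 0 + (bvec o v) 1 = 0 ∧ (bvec o v) 0 + (bvec o v) 2 = 0) ↔ ((0 : Fin 24) ∉ osupp o ∧ (1 : Fin 24) ∉ osupp o ∧ (2 : Fin 24) ∉ osupp o) ∨
      (((0 : Fin 24) ∈ osupp o ∧ (1 : Fin 24) ∈ osupp o ∧ (2 : Fin 24) ∈ osupp o) ∧
        (v.testBit 1 = !v.testBit 0 ∧ v.testBit 2 = !v.testBit 0)) := by
  by_cases h0 : (0 : Fin 24) ∈ osupp o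
  · by_cases h1 : (1 : Fin 24) ∈ osupp o
    · by_cases h2 : (2 : Fin 24) ∈ osupp o
      · have hp : ∀ j : Fin 24, j.val ≤ 2 → j ∈ osupp o := by
          intro j hj
          rcases Nat.lt_or_ge j.val 1 with h | h
          · rw [show j = 0 from Fin.ext (by simp; omega)]; exact h0
          rcases Nat.lt_or_ge j.val 2 with h' | h'
          · rw [show j = 1 from Fin.ext (by simp; omega)]; exact h1
          · rw [show j = 2 from Fin.ext (by simp; omega)]; exact h2
        rw [bvec_apply_prefix o v (by norm_num) hp 0 (by decide), bvec_apply_prefix o v (by norm_num) hp 1 (by decide),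
          bvec_apply_prefix o v (by norm_num) hp 2 (by decide)]
        have key : ∀ b0 b1 b2 : Bool, (2 * sgn b0 + 2 * sgn b1 = 0 ∧ 2 * sgn b0 + 2 * sgn b2 = 0) ↔
            (b1 = !b0 ∧ b2 = !b0) := by decide
        simp only [Fin.val_zero, Fin.val_one, Fin.val_two, key]
        simp [h0, h1, h2]
      · rw [(bvec_eq_zero_iff o v 2).mpr h2, add_zero]
        have : bvec o v 0 ≠ 0 := (bvec_ne_zero_iff o v 0).mpr h0
        simp [h0, h1, h2, this]
    · rw [(bvec_eq_zero_iff o v 1).mpr h1, add_zero]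
      have : bvec o v 0 ≠ 0 := (bvec_ne_zero_iff o v 0).mpr h0
      simp [h0, h1, this]
  · rw [(bvec_eq_zero_iff o v 0).mpr h0, zero_add, zero_add]
    simp [h0, bvec_eq_zero_iff]

/-- `Λ₂₁`-condition on shape `B`. -/
theorem P21_bvec_iff (o : Fin 759) (v : ℕ) :
    ((bvec o v) 0 + (bvec o v) 1 = 0 ∧ (bvec o v) 2 - (bvec o v) 0 = 0 ∧ (bvec o v) 3 - (bvec o v) 1 = 0) ↔
      ((0 : Fin 24) ∉ osupp o ∧ (1 : Fin 24) ∉ osupp o ∧ (2 : Fin 24) ∉ osupp o ∧ (3 : Fin 24) ∉ osupp o) ∨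
      (((0 : Fin 24) ∈ osupp o ∧ (1 : Fin 24) ∈ osupp o ∧ (2 : Fin 24) ∈ osupp o ∧ (3 : Fin 24) ∈ osupp o) ∧
        (v.testBit 1 = !v.testBit 0 ∧ v.testBit 2 = v.testBit 0 ∧ v.testBit 3 = !v.testBit 0)) := by
  by_cases h0 : (0 : Fin 24) ∈ osupp o
  · have hne0 : bvec o v 0 ≠ 0 := (bvec_ne_zero_iff o v 0).mpr h0
    by_cases h1 : (1 : Fin 24) ∈ osupp o
    · have hne1 : bvec o v 1 ≠ 0 := (bvec_ne_zero_iff o v 1).mpr h1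
      by_cases h2 : (2 : Fin 24) ∈ osupp o
      · by_cases h3 : (3 : Fin 24) ∈ osupp o
        · have hp : ∀ j : Fin 24, j.val ≤ 3 → j ∈ osupp o := by
            intro j hj
            rcases Nat.lt_or_ge j.val 1 with h | h
            · rw [show j = 0 from Fin.ext (by simp; omega)]; exact h0
            rcases Nat.lt_or_ge j.val 2 with h' | h'
            · rw [show j = 1 from Fin.ext (by simp; omega)]; exact h1
            rcases Nat.lt_or_ge j.val 3 with h'' | h''
            · rw [show j = 2 from Fin.ext (by simp; omega)]; exact h2
            · rw [show j = 3 from Fin.ext (by simp; omega)]; exact h3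
          rw [bvec_apply_prefix o v (by norm_num) hp 0 (by decide), bvec_apply_prefix o v (by norm_num) hp 1 (by decide),
            bvec_apply_prefix o v (by norm_num) hp 2 (by decide), bvec_apply_prefix o v (by norm_num) hp 3 (by decide)]
          have key : ∀ b0 b1 b2 b3 : Bool,
              (2 * sgn b0 + 2 * sgn b1 = 0 ∧ 2 * sgn b2 - 2 * sgn b0 = 0 ∧ 2 * sgn b3 - 2 * sgn b1 = 0) ↔
              (b1 = !b0 ∧ b2 = b0 ∧ b3 = !b0) := by decide
          have h3v : (3 : Fin 24).val = 3 := rfl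
          simp only [Fin.val_zero, Fin.val_one, Fin.val_two, h3v, key]
          simp [h0, h1, h2, h3]
        · rw [(bvec_eq_zero_iff o v 3).mpr h3, zero_sub]
          simp [h0, h1, h2, h3, hne1]
      · rw [(bvec_eq_zero_iff o v 2).mpr h2, zero_sub]
        simp [h0, h1, h2, hne0]
    · rw [(bvec_eq_zero_iff o v 1).mpr h1, add_zero]
      simp [h0, h1, hne0]
  · rw [(bvec_eq_zero_iff o v 0).mpr h0, zero_add, sub_zero]
    by_cases h1 : (1 : Fin 24) ∈ osupp o
    · have hne1 : bvec o v 1 ≠ 0 := (bvec_ne_zero_iff o v 1).mpr h1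
      simp [h0, h1, hne1]
    · rw [(bvec_eq_zero_iff o v 1).mpr h1, sub_zero]
      simp [h0, h1, bvec_eq_zero_iff]

end Summit.Ventures.PackingBounds.Config.Leech
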